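import Summits.QuantumFields.YangMills.Theorems.ParabolicTrajectoryLatticeGapOnTrajectorySparseDefectFamiliesDefs
import Summits.QuantumFields.YangMills.Theorems.ParabolicTrajectoryLatticeGapOnTrajectoryStubWilsonTorusDLR
import HarnessLib

/-!
# Crux `LatticeGapOnTrajectory` (stmt-QuantumFields-10523), line `sparse-defect-orbit-window`:
# stub (T2) `stub_hereditaryOfCondFamilies` — hereditary sparseness of family-type bad cells from a
# conditional large-field bound

Registered stub (T2) of the line skeleton, `--supports stmt-QuantumFields-10523` (G-blind finite
probability; nothing about mass gaps is asserted, everything here is proved). It is the kernel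
analogue of the union-bound stub (U) `stub_sparseUnderOfLargeField`: the window kernel
`torusYM r.ρ β (2S+1) (windowVol (cellOf q) n c) ω` replaces Wilson's torus measure.

If for every window centre `c`, every boundary datum `ω` that is family-good on the shell of `W(c)`,
every set `X` of window cells and every choice function `φ`, the window kernel gives the event
"every plaquette of `P x (φ x)` is `ε₀`-large for all `x ∈ X`" probability at most `e^{−κ m |X|}`,
then the family-type bad cells are hereditarily jointly `(J e^{−κ m})`-sparse under the window
kernels: `HereditarySparse (cellOf q) (torusYM r.ρ β (2S+1)) n (familyGood r ε₀ P) (J e^{−κ m})`.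

Proof (union bound). Fix `c, ω, X`. For `X = ∅` the bound is `γ(univ) ≤ 1 = (J e^{−κm})^0` (the
kernels are probability measures, `isSpecification_torusYM`). For `X ≠ ∅`: a configuration bad on
every `x ∈ X` has, for each `x ∈ X`, a family index `ψ x : Fin J` with `P x (ψ x)` entirely
`ε₀`-large (`not_mem_familyGood_iff`); extending `ψ` to a total choice function (constant `ψ x₀` off
`X`, `x₀ ∈ X`), the bad event is covered by the `J^{|X|}` prescribed events of the hypothesis indexed
by `ψ : X → Fin J`, each of probability `≤ e^{−κ m |X|} = (e^{−κ m})^{|X|}`; summing,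
`J^{|X|} (e^{−κm})^{|X|} = (J e^{−κm})^{|X|}`.
-/

set_option autoImplicit false

noncomputable section

namespace Summit.QuantumFields.YangMills.Cruxes.LatticeGapOnTrajectory.SparseDefectOrbitWindow

open scoped BigOperators ENNReal
open Filter MeasureTheory
open Literature.Probability.LatticeModels (Specification IsSpecification IsGibbsMeasure glueWith)
open Literature.MathematicalPhysics.QuantumFieldTheory
open Summit.QuantumFields.YangMills.Cruxes.LatticeGapOnTrajectory.OrbitKantorovichFiniteSize

namespace StubHereditaryOfCondFamilies

/-- The exponent bookkeeping: `exp (−(t k)) = (exp (−t)) ^ k` for a natural number `k`. -/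
theorem exp_neg_mul_natCast (t : ℝ) (k : ℕ) : Real.exp (-(t * k)) = Real.exp (-t) ^ k := by
  rw [← Real.exp_nat_mul]
  congr 1
  ring

/-- Extension of choice functions: every function on (the subtype of) a nonempty finset `X` is the
restriction of a total function. -/
theorem exists_extend {ι α : Type} [DecidableEq ι] (X : Finset ι) {x₀ : ι} (hx₀ : x₀ ∈ X)
    (ψ : ↥X → α) : ∃ φ : ι → α, ∀ (x : ι) (hx : x ∈ X), φ x = ψ ⟨x, hx⟩ :=
  ⟨fun x => if hx : x ∈ X then ψ ⟨x, hx⟩ else ψ ⟨x₀, hx₀⟩, fun _ hx => dif_pos hx⟩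

end StubHereditaryOfCondFamilies

open StubSparseUnderOfLargeField StubHereditaryOfCondFamilies in
/-- **Stub (T2) `stub_hereditaryOfCondFamilies`** (G-blind TOOL, M): hereditary joint sparseness of
family-type bad cells from a CONDITIONAL large-field bound by the union bound over choice functions
(kernel analogue of stub (U)). For cell-carried families `P x j` (`j : Fin J`), a level `κ ≥ 0` and a
size parameter `m`: if for every window centre `c`, every boundary datum `ω` family-good on the shell
of `W(c)`, every set `X` of window cells and every choice function `φ`, the window kernel gives the
event "every plaquette of `P x (φ x)` is `ε₀`-large for all `x ∈ X`" probability at most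
`e^{−κ m |X|}`, then `HereditarySparse (cellOf q) (torusYM r.ρ β (2S+1)) n (familyGood r ε₀ P) (J e^{−κm})`.
(Bad on `x` = some family of `x` entirely large, `not_mem_familyGood_iff`; sum over the `J^{|X|}`
restrictions of choice functions to `X`; the kernels are probability measures,
`isSpecification_torusYM`.) -/
theorem stub_hereditaryOfCondFamilies :
    ∀ (G : Type) [Group G] [TopologicalSpace G] [IsTopologicalGroup G] [CompactSpace G]
      [MeasurableSpace G] [BorelSpace G] (r : LatticeRep G) (ε₀ κ β : ℝ) {S : ℕ} {μ : Fin 4 → ℕ}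
      (q : (i : Fin 4) → ZMod (2 * S + 1) → ZMod (μ i + 1)) (n : ℕ) {J : ℕ} (m : ℕ)
      (P : CoarseIdx μ → Fin J → Finset (Plaquette 4 (2 * S + 1))), 0 ≤ κ →
      (∀ (c : CoarseIdx μ) (ω : GaugeConfig 4 (2 * S + 1) G),
          (∀ y, cdist c y = n + 1 → ω ∈ familyGood r ε₀ P y) →
          ∀ (X : Finset (CoarseIdx μ)) (φ : CoarseIdx μ → Fin J), (∀ x ∈ X, cdist c x ≤ n) →
            torusYM r.ρ β (2 * S + 1) (windowVol (cellOf q) n c) ω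
                {U | ∀ x ∈ X, ∀ p ∈ P x (φ x),
                  ε₀ ≤ (r.N : ℝ) - (r.ρ (plaquetteHolonomy U p.1 p.2.1.1 p.2.1.2)).trace.re} ≤
              ENNReal.ofReal (Real.exp (-(κ * m * X.card)))) →
        HereditarySparse (cellOf q) (torusYM r.ρ β (2 * S + 1)) n (familyGood r ε₀ P)
          ((J : ℝ) * Real.exp (-(κ * m))) := by
  intro G _ _ _ _ _ _ r ε₀ κ β S μ q n J m P _ hcond c ω hω X hX
  classical
  haveI : IsProbabilityMeasure (torusYM r.ρ β (2 * S + 1) (windowVol (cellOf q) n c) ω) :=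
    (isSpecification_torusYM r β (2 * S + 1)).isProbability _ _
  rcases X.eq_empty_or_nonempty with rfl | ⟨x₀, hx₀⟩
  · -- no cells: the event is everything, of probability at most `1 = (J e^{−κm})^0`
    calc torusYM r.ρ β (2 * S + 1) (windowVol (cellOf q) n c) ω
          {σ | ∀ x ∈ (∅ : Finset (CoarseIdx μ)), σ ∉ familyGood r ε₀ P x}
        ≤ 1 := prob_le_one
      _ = ENNReal.ofReal (((J : ℝ) * Real.exp (-(κ * m))) ^ (∅ : Finset (CoarseIdx μ)).card) := by
          rw [Finset.card_empty, pow_zero, ENNReal.ofReal_one]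
  · -- the large-field predicate of a plaquette
    set large : GaugeConfig 4 (2 * S + 1) G → Plaquette 4 (2 * S + 1) → Prop := fun U p =>
      ε₀ ≤ (r.N : ℝ) - (r.ρ (plaquetteHolonomy U p.1 p.2.1.1 p.2.1.2)).trace.re
    -- total extensions of the choice functions on `X`
    choose Φ hΦ using fun ψ : ↥X → Fin J => exists_extend X hx₀ ψ
    -- (1) cover of the bad event by the `J ^ |X|` prescribed events
    have hcov : {σ : GaugeConfig 4 (2 * S + 1) G | ∀ x ∈ X, σ ∉ familyGood r ε₀ P x} ⊆
        ⋃ ψ : ↥X → Fin J, {U | ∀ x ∈ X, ∀ p ∈ P x (Φ ψ x), large U p} := by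
      intro σ hσ
      choose j hj using fun x : ↥X => (not_mem_familyGood_iff r ε₀ P x.1 σ).1 (hσ x.1 x.2)
      refine Set.mem_iUnion.2 ⟨j, fun x hx p hp => ?_⟩
      rw [hΦ j x hx] at hp
      exact hj ⟨x, hx⟩ p hp
    -- (2) each piece is bounded by the conditional large-field hypothesis
    have hpiece : ∀ ψ : ↥X → Fin J,
        torusYM r.ρ β (2 * S + 1) (windowVol (cellOf q) n c) ω
            {U | ∀ x ∈ X, ∀ p ∈ P x (Φ ψ x), large U p} ≤
          ENNReal.ofReal (Real.exp (-(κ * m)) ^ X.card) := fun ψ =>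
      (hcond c ω hω X (Φ ψ) hX).trans (le_of_eq (by rw [exp_neg_mul_natCast]))
    -- (3) union bound and bookkeeping
    calc torusYM r.ρ β (2 * S + 1) (windowVol (cellOf q) n c) ω
          {σ | ∀ x ∈ X, σ ∉ familyGood r ε₀ P x}
        ≤ torusYM r.ρ β (2 * S + 1) (windowVol (cellOf q) n c) ω
            (⋃ ψ : ↥X → Fin J, {U | ∀ x ∈ X, ∀ p ∈ P x (Φ ψ x), large U p}) := measure_mono hcov
      _ ≤ ∑ ψ : ↥X → Fin J, torusYM r.ρ β (2 * S + 1) (windowVol (cellOf q) n c) ω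
            {U | ∀ x ∈ X, ∀ p ∈ P x (Φ ψ x), large U p} := measure_iUnion_fintype_le _ _
      _ ≤ ∑ _ψ : ↥X → Fin J, ENNReal.ofReal (Real.exp (-(κ * m)) ^ X.card) :=
          Finset.sum_le_sum fun ψ _ => hpiece ψ
      _ = (J ^ X.card) • ENNReal.ofReal (Real.exp (-(κ * m)) ^ X.card) := by
          rw [Finset.sum_const, Finset.card_univ, Fintype.card_fun, Fintype.card_fin,
            Fintype.card_coe]
      _ = ENNReal.ofReal (((J : ℝ) * Real.exp (-(κ * m))) ^ X.card) :=
          pow_nsmul_ofReal_pow J X.card _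

end Summit.QuantumFields.YangMills.Cruxes.LatticeGapOnTrajectory.SparseDefectOrbitWindow

end
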